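import Literature.Probability.LatticeModels.RandomCurrentsMixingCore
import Literature.Probability.LatticeModels.TwoSiteNumerics
import Literature.Probability.LatticeModels.BoxTwoPointTransfer
import HarnessLib

/-!
# The concentration inputs of the mixing core on a finite volume of `ℤ^d` (Aizenman–Duminil-Copin 2021, Prop. 6.6)

Topic `Literature/Probability/LatticeModels`. Definitions with bodies and theorems; **no named fact is
introduced** (D-0026).

M. Aizenman, H. Duminil-Copin, Ann. of Math. **194** (2021) = arXiv:1912.07973, §6.2. The abstract mixing
core `Current.mixingCore` (tree: `RandomCurrentsMixingCore`, the inequality (6.16)) takes as hypotheses,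
for each sourced pair `(x, y)`, coefficients `c` on the vertices with
`(hc)  ∑_v c(v) Z[xv]Z[vy] = Z[xy]Z[∅]` ("`E^{xy,∅}[𝐍ᵢ] = 1`") and
`(hB)  Z[∅] ∑ w 𝐍² ≤ q Z[xy]Z[∅]²` ("`E^{xy,∅}[𝐍ᵢ²] ≤ 1 + C₂/|𝒦|`", Prop. 6.6 via (6.5)).
This file supplies them on the induced graph `boxGraph Λ` of a finite `Λ ⊆ ℤ^d` with constant couplings
`β`, for the printed coefficients "`c(u) = 1/(|𝒦| A_{x,y}(2^k))` for `u ∈ 𝔸_y(2^k)`, `k ∈ 𝒦`" built from the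
FINITE-VOLUME two-point functions (so that (hc) is an identity), and derives (hB) from the deterministic
two-site numerics `TwoSiteNumerics.sum_inv_mul_sum_twoSiteTerm_le` for the infinite-volume two-point
function `S = twoPointFree d β` together with a two-sided comparison
`(1-η) S(b-a) ≤ ⟨σ_aσ_b⟩_Λ ≤ S(b-a)` on the finitely many pairs involved (the upper bound always holds,
`BoxTwoPointTransfer`; the lower bound holds for `Λ = Λ_L`, `L` large):

* `boxTwoPt Λ β a b = ⟨σ_aσ_b⟩^free_{Λ,β} = Z_Λ[{a,b}]/Z_Λ[∅]` (`boxTwoPt_eq_div`), `≤ S(b-a)` (`boxTwoPt_le`);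
* `Current.blk`, `Current.blkSum`, `Current.mixCoeff` — the blocks `x + I_k` and the coefficients;
  `Current.sum_mixCoeff_mul` — **(hc)** exactly; `Current.mixCoeff_ne_top`, `Current.exists_mem_of_mixCoeff_ne_zero`;
* `Current.mixCoeff_secondMoment_le` — **(hB)** with
  `q = (1-η)⁻⁵ (1 + C_*/|𝒦|)` under the hypotheses of the two-site numerics (regular separated scales `𝒦`,
  index sets `I_k ⊆ Ann(2^k,2^{k+1})` of size `≥ γ2^{dk}` inside `Λ - x`, domination for the far source) and
  the comparison with `S` on `x + (I ∪ {0, y-x})`.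

## References

* M. Aizenman, H. Duminil-Copin, Ann. of Math. 194 (2021), arXiv:1912.07973, §6.2, Prop. 6.6 and its proof
  ((6.4)–(6.5), "E[𝐍ᵢ] = 1", pp. 23–24) [AizenmanDuminilCopinAnnals2021].
-/

noncomputable section

open Finset Filter
open scoped symmDiff ENNReal

namespace Literature.Probability.LatticeModels

variable {d : ℕ}

/-! ### Dictionary: the finite-volume two-point function of `boxGraph Λ` -/

/-- The constant couplings `β` on the bonds of `boxGraph Λ`. [folklore] -/
abbrev Kc (Λ : Finset (Site d)) (β : ℝ) : (boxGraph Λ).edgeFinset → ℝ := fun _ => β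

/-- The free finite-volume two-point function `⟨σ_aσ_b⟩^free_{Λ,β}` of the induced graph on `Λ`.
[cite: AizenmanDuminilCopinAnnals2021, arXiv:1912.07973 §6.2, the correlations ⟨σ_xσ_u⟩ in a_{x,y}(u) (p. 23)] -/
def boxTwoPt (Λ : Finset (Site d)) (β : ℝ) (a b : ↥Λ) : ℝ := isingTwoPoint (boxGraph Λ) univ β 0 .free a b

/-- **Random-current representation**: `⟨σ_aσ_b⟩_Λ = Z_Λ[{a}Δ{b}]/Z_Λ[∅]` (`β ≥ 0`). [cite: DuminilCopin2019, §4.1 (random current representation of correlations)] -/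
theorem boxTwoPt_eq_div {Λ : Finset (Site d)} {β : ℝ} (hβ : 0 ≤ β) (a b : ↥Λ) :
    boxTwoPt Λ β a b = (ecurrentSum (Kc Λ β) ({a} ∆ {b})).toReal / (ecurrentSum (Kc Λ β) ∅).toReal := by
  have hK : ∀ e, 0 ≤ Kc Λ β e := fun _ => hβ
  unfold boxTwoPt
  rw [isingTwoPoint_free_eq_currentSum_div_holds, currentSum_eq_wcurrentSum, currentSum_eq_wcurrentSum,
    ecurrentSum_eq_ofReal hK, ecurrentSum_eq_ofReal hK, ENNReal.toReal_ofReal (wcurrentSum_nonneg hK _),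
    ENNReal.toReal_ofReal (wcurrentSum_nonneg hK _)]

/-- `⟨σ_aσ_b⟩_Λ ≤ S_β(b - a)` (Griffiths monotonicity in the volume). [cite: FriedliVelenik2017, Exercise 3.16 (p. 114)] -/
theorem boxTwoPt_le {Λ : Finset (Site d)} {β : ℝ} (hβ : 0 ≤ β) (a b : ↥Λ) :
    boxTwoPt Λ β a b ≤ twoPointFree d β ((b : Site d) - a) := by
  unfold boxTwoPt
  rw [← isingTwoPoint_free_eq_boxGraph Λ β a b]
  exact isingTwoPoint_box_le_twoPointFree hβ a.2 b.2

/-- Symmetry `⟨σ_aσ_b⟩_Λ = ⟨σ_bσ_a⟩_Λ`. [folklore] -/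
theorem boxTwoPt_comm {Λ : Finset (Site d)} {β : ℝ} (hβ : 0 ≤ β) (a b : ↥Λ) :
    boxTwoPt Λ β a b = boxTwoPt Λ β b a := by
  rw [boxTwoPt_eq_div hβ, boxTwoPt_eq_div hβ, symmDiff_comm]

/-- `Z_Λ[{a}Δ{b}] = ⟨σ_aσ_b⟩_Λ · Z_Λ[∅]` in `ℝ`. [folklore] -/
theorem toReal_ecurrentSum_pair {Λ : Finset (Site d)} {β : ℝ} (hβ : 0 ≤ β) (a b : ↥Λ) :
    (ecurrentSum (Kc Λ β) ({a} ∆ {b})).toReal = boxTwoPt Λ β a b * (ecurrentSum (Kc Λ β) ∅).toReal := by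
  have hK : ∀ e, 0 ≤ Kc Λ β e := fun _ => hβ
  have h0 : (ecurrentSum (Kc Λ β) ∅).toReal ≠ 0 :=
    (ENNReal.toReal_pos (ecurrentSum_empty_ne_zero _) (ecurrentSum_ne_top hK _)).ne'
  rw [boxTwoPt_eq_div hβ, div_mul_cancel₀ _ h0]

namespace Current

/-! ### The coefficients `c(u) = 1/(|𝒦| A_{x,y}(2^k))` -/

section Coeff

variable {Λ : Finset (Site d)}

/-- The block of switch points `x + I_k` inside `Λ`. [cite: AizenmanDuminilCopinAnnals2021, arXiv:1912.07973 §6.2, the sets 𝔸_y(2^k) (p. 23)] -/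
def blk (x : ↥Λ) (I : ℕ → Finset (Site d)) (k : ℕ) : Finset ↥Λ :=
  univ.filter fun v => ((v : Site d) - x) ∈ I k

/-- The block sum `∑_{u ∈ x + I_k} Z[xu]Z[uy]` (`= |…| A_{x,y}(2^k) · Z[xy]Z[∅]` in finite volume). [cite: AizenmanDuminilCopinAnnals2021, arXiv:1912.07973 §6.2, A_{x,y}(m) (p. 23)] -/
def blkSum (β : ℝ) (x y : ↥Λ) (I : ℕ → Finset (Site d)) (k : ℕ) : ℝ≥0∞ :=
  ∑ u ∈ blk x I k, ecurrentSum (Kc Λ β) ({x} ∆ {u}) * ecurrentSum (Kc Λ β) ({u} ∆ {y})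

/-- **The coefficients of `𝐍ᵢ`**: `c(v) = Z[xy]Z[∅]/(|𝒦| · ∑_{u ∈ x+I_k} Z[xu]Z[uy])` for `v ∈ x + I_k`, `k ∈ 𝒦`
(i.e. `1/(|𝒦| A_{x,y}(2^k))` with the finite-volume `a_{x,y}(u) = ⟨σ_xσ_u⟩⟨σ_uσ_y⟩/⟨σ_xσ_y⟩`), `0` elsewhere.
[cite: AizenmanDuminilCopinAnnals2021, arXiv:1912.07973 §6.2, definition of 𝐍ᵢ (p. 23)] -/
def mixCoeff (β : ℝ) (x y : ↥Λ) (𝒦 : Finset ℕ) (I : ℕ → Finset (Site d)) (v : ↥Λ) : ℝ≥0∞ :=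
  ∑ k ∈ 𝒦, if ((v : Site d) - x) ∈ I k then
    ecurrentSum (Kc Λ β) ({x} ∆ {y}) * ecurrentSum (Kc Λ β) ∅ * (((#𝒦 : ℕ) : ℝ≥0∞)⁻¹ * (blkSum β x y I k)⁻¹)
  else 0

variable {β : ℝ} (x y : ↥Λ) (𝒦 : Finset ℕ) (I : ℕ → Finset (Site d))

/-- Block sums are finite (`β ≥ 0`). [folklore] -/
theorem blkSum_ne_top (hβ : 0 ≤ β) (k : ℕ) : blkSum β x y I k ≠ ∞ := by
  have hK : ∀ e, 0 ≤ Kc Λ β e := fun _ => hβ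
  unfold blkSum
  exact ENNReal.sum_ne_top.2 fun u _ => ENNReal.mul_ne_top (ecurrentSum_ne_top hK _) (ecurrentSum_ne_top hK _)

/-- The coefficients are finite when the blocks have non-zero sums. [folklore] -/
theorem mixCoeff_ne_top (hβ : 0 ≤ β) (hblk : ∀ k ∈ 𝒦, blkSum β x y I k ≠ 0) (v : ↥Λ) :
    mixCoeff β x y 𝒦 I v ≠ ∞ := by
  have hK : ∀ e, 0 ≤ Kc Λ β e := fun _ => hβ
  unfold mixCoeff
  refine ENNReal.sum_ne_top.2 fun k hk => ?_
  split_ifs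
  · refine ENNReal.mul_ne_top (ENNReal.mul_ne_top (ecurrentSum_ne_top hK _) (ecurrentSum_ne_top hK _))
      (ENNReal.mul_ne_top ?_ ?_)
    · rw [ENNReal.inv_ne_top]; exact_mod_cast (card_pos.2 ⟨k, hk⟩).ne'
    · rw [ENNReal.inv_ne_top]; exact hblk k hk
  · exact ENNReal.zero_ne_top

/-- The coefficients are supported on the blocks. [folklore] -/
theorem exists_mem_of_mixCoeff_ne_zero {v : ↥Λ} (h : mixCoeff β x y 𝒦 I v ≠ 0) :
    ∃ k ∈ 𝒦, ((v : Site d) - x) ∈ I k := by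
  by_contra hne
  push Not at hne
  apply h
  unfold mixCoeff
  exact Finset.sum_eq_zero fun k hk => if_neg (hne k hk)

/-- **(hc): `E^{xy,∅}[𝐍ᵢ] = 1`** — `∑_v c(v) Z[xv]Z[vy] = Z[xy]Z[∅]`, an identity for the finite-volume
coefficients (non-empty `𝒦`, blocks with non-zero sums). [cite: AizenmanDuminilCopinAnnals2021, arXiv:1912.07973 §6.2, proof of Prop. 6.6 ("the switching lemma and the definition of 𝐍ᵢ imply that E^{xy,∅}[𝐍ᵢ] = 1", p. 23)] -/
theorem sum_mixCoeff_mul (hβ : 0 ≤ β) (h𝒦 : 𝒦.Nonempty) (hblk : ∀ k ∈ 𝒦, blkSum β x y I k ≠ 0) :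
    ∑ v, mixCoeff β x y 𝒦 I v * (ecurrentSum (Kc Λ β) ({x} ∆ {v}) * ecurrentSum (Kc Λ β) ({v} ∆ {y})) =
      ecurrentSum (Kc Λ β) ({x} ∆ {y}) * ecurrentSum (Kc Λ β) ∅ := by
  classical
  set γ : ℕ → ℝ≥0∞ := fun k => ecurrentSum (Kc Λ β) ({x} ∆ {y}) * ecurrentSum (Kc Λ β) ∅ *
    (((#𝒦 : ℕ) : ℝ≥0∞)⁻¹ * (blkSum β x y I k)⁻¹) with hγ
  have hexp : ∀ v : ↥Λ, mixCoeff β x y 𝒦 I v * (ecurrentSum (Kc Λ β) ({x} ∆ {v}) * ecurrentSum (Kc Λ β) ({v} ∆ {y})) =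
      ∑ k ∈ 𝒦, if ((v : Site d) - x) ∈ I k then
        γ k * (ecurrentSum (Kc Λ β) ({x} ∆ {v}) * ecurrentSum (Kc Λ β) ({v} ∆ {y})) else 0 := by
    intro v
    unfold mixCoeff
    rw [Finset.sum_mul]
    refine Finset.sum_congr rfl fun k _ => ?_
    split_ifs <;> simp [hγ]
  simp_rw [hexp]
  rw [Finset.sum_comm]
  have hblock : ∀ k ∈ 𝒦, ∑ v : ↥Λ, (if ((v : Site d) - x) ∈ I k then
      γ k * (ecurrentSum (Kc Λ β) ({x} ∆ {v}) * ecurrentSum (Kc Λ β) ({v} ∆ {y})) else 0) =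
      ecurrentSum (Kc Λ β) ({x} ∆ {y}) * ecurrentSum (Kc Λ β) ∅ * ((#𝒦 : ℕ) : ℝ≥0∞)⁻¹ := by
    intro k hk
    rw [← Finset.sum_filter, ← Finset.mul_sum]
    change γ k * blkSum β x y I k = _
    rw [hγ]
    simp only []
    rw [show ecurrentSum (Kc Λ β) ({x} ∆ {y}) * ecurrentSum (Kc Λ β) ∅ * ((((#𝒦 : ℕ) : ℝ≥0∞))⁻¹ * (blkSum β x y I k)⁻¹) *
        blkSum β x y I k = ecurrentSum (Kc Λ β) ({x} ∆ {y}) * ecurrentSum (Kc Λ β) ∅ * (((#𝒦 : ℕ) : ℝ≥0∞))⁻¹ *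
        ((blkSum β x y I k)⁻¹ * blkSum β x y I k) by ring,
      ENNReal.inv_mul_cancel (hblk k hk) (blkSum_ne_top x y I hβ k), mul_one]
  rw [Finset.sum_congr rfl hblock, Finset.sum_const, nsmul_eq_mul]
  have hcard0 : ((#𝒦 : ℕ) : ℝ≥0∞) ≠ 0 := by exact_mod_cast (card_pos.2 h𝒦).ne'
  have hcardtop : ((#𝒦 : ℕ) : ℝ≥0∞) ≠ ∞ := ENNReal.natCast_ne_top _
  calc ((#𝒦 : ℕ) : ℝ≥0∞) * (ecurrentSum (Kc Λ β) ({x} ∆ {y}) * ecurrentSum (Kc Λ β) ∅ * ((#𝒦 : ℕ) : ℝ≥0∞)⁻¹)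
      = ecurrentSum (Kc Λ β) ({x} ∆ {y}) * ecurrentSum (Kc Λ β) ∅ * (((#𝒦 : ℕ) : ℝ≥0∞) * ((#𝒦 : ℕ) : ℝ≥0∞)⁻¹) := by
        ring
    _ = _ := by rw [ENNReal.mul_inv_cancel hcard0 hcardtop, mul_one]

/-! ### Sums over the blocks -/

/-- Re-indexing a block by the index set: `∑_{v ∈ x + I_k} f(v - x) = ∑_{u ∈ I_k} f(u)` when `x + I_k ⊆ Λ`.
[folklore] -/
theorem sum_blk_eq (k : ℕ) (hIΛ : ∀ u ∈ I k, (x : Site d) + u ∈ Λ) (f : Site d → ℝ) :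
    ∑ v ∈ blk x I k, f ((v : Site d) - x) = ∑ u ∈ I k, f u := by
  classical
  refine Finset.sum_nbij' (fun v : ↥Λ => (v : Site d) - x)
    (fun u : Site d => if h : (x : Site d) + u ∈ Λ then ⟨(x : Site d) + u, h⟩ else x) ?_ ?_ ?_ ?_ ?_
  · intro v hv; unfold blk at hv; exact (mem_filter.1 hv).2
  · intro u hu
    unfold blk
    rw [mem_filter, dif_pos (hIΛ u hu)]
    refine ⟨mem_univ _, ?_⟩
    simpa using hu
  · intro v _
    have h : (x : Site d) + ((v : Site d) - x) ∈ Λ := by rw [add_sub_cancel]; exact v.2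
    rw [dif_pos h]
    ext1
    simp
  · intro u hu
    rw [dif_pos (hIΛ u hu)]
    simp
  · intro v _; rfl

/-- The blocks have the size of the index sets (`x + I_k ⊆ Λ`). [folklore] -/
theorem card_blk_eq (k : ℕ) (hIΛ : ∀ u ∈ I k, (x : Site d) + u ∈ Λ) : (#(blk x I k) : ℝ) = #(I k) := by
  have h := sum_blk_eq x I k hIΛ (fun _ => (1 : ℝ))
  simp only [Finset.sum_const, nsmul_eq_mul, mul_one] at h
  exact h

/-! ### (hB): the second moment of `𝐍ᵢ` -/

/-- **The real-variable core of (hB).** For a positive `S`, a kernel `T ≤ S(· - ·)` on `Λ` with the lower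
comparison `(1-η)S ≤ T` on the pairs `(x,y)`, `(x,v)`, `(v,y)` (`v` in the blocks), and the hypotheses of the
two-site numerics for `S` at the relative far source `y - x`:
`∑_{k,ℓ} [T_{xy}/(|𝒦|B_k)][T_{xy}/(|𝒦|B_ℓ)] ∑_{v ∈ x+I_k, w ∈ x+I_ℓ} (T_{xw}T_{wv}T_{vy} + T_{xv}T_{vw}T_{wy})`
`≤ (1-η)⁻⁵ (1 + C_*/|𝒦|) T_{xy}`, `B_k = ∑_{u ∈ x+I_k} T_{xu}T_{uy}`.
[cite: AizenmanDuminilCopinAnnals2021, arXiv:1912.07973 §6.2, proof of Prop. 6.6 ((6.4)–(6.5), pp. 23–24)] -/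
theorem real_secondMoment_le {S : Site d → ℝ} (hS : ∀ z, 0 < S z) (T : ↥Λ → ↥Λ → ℝ)
    (hTle : ∀ a b, T a b ≤ S ((b : Site d) - a)) (hTnn : ∀ a b, 0 ≤ T a b)
    (i₀ : Fin d) {c C κ Y γ η : ℝ} (hc : 0 < c) (hC : 0 ≤ C) (hκ : 0 ≤ κ) (hγ : 0 < γ) (hη1 : η < 1)
    (h𝒦 : 𝒦.Nonempty) (hreg : ∀ j ∈ 𝒦, IsRegularScale S c C (2 ^ j))
    (hsep : ∀ j ∈ 𝒦, ∀ j' ∈ 𝒦, j < j' → (C + 2) * 2 ^ j < (2 ^ j' : ℝ))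
    (hY : ∀ j ∈ 𝒦, (2 ^ j : ℝ) ≤ Y) (hI : ∀ j ∈ 𝒦, I j ⊆ ann d (2 ^ j) (2 * 2 ^ j))
    (hcard : ∀ j ∈ 𝒦, γ * (2 ^ j : ℝ) ^ d ≤ #(I j))
    (hdom : ∀ j ∈ 𝒦, ∀ u ∈ I j, S ((y : Site d) - x) ≤ (1 + κ * 2 ^ j / Y) * S ((y : Site d) - x - u))
    (hIΛ : ∀ j ∈ 𝒦, ∀ u ∈ I j, (x : Site d) + u ∈ Λ)
    (hlow_xy : (1 - η) * S ((y : Site d) - x) ≤ T x y)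
    (hlow_blk : ∀ j ∈ 𝒦, ∀ v ∈ blk x I j,
      (1 - η) * S ((v : Site d) - x) ≤ T x v ∧ (1 - η) * S ((y : Site d) - v) ≤ T v y) :
    ∑ k ∈ 𝒦, ∑ ℓ ∈ 𝒦, (T x y / (#𝒦 * ∑ u ∈ blk x I k, T x u * T u y)) * (T x y / (#𝒦 * ∑ u ∈ blk x I ℓ, T x u * T u y)) *
        ∑ v ∈ blk x I k, ∑ w ∈ blk x I ℓ, (T x w * T w v * T v y + T x v * T v w * T w y) ≤
      (1 - η)⁻¹ ^ 5 * (1 + ((2 * C * ((1 + (1 + c) / c) * 9 ^ d * C ^ 2 * (1 + κ) / γ)) +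
        4 * ((1 + κ) * C + (2 * C + κ + 2 * C * κ))) / #𝒦) * T x y := by
  set Cst : ℝ := (2 * C * ((1 + (1 + c) / c) * 9 ^ d * C ^ 2 * (1 + κ) / γ)) +
    4 * ((1 + κ) * C + (2 * C + κ + 2 * C * κ)) with hCst
  set y' : Site d := (y : Site d) - x with hy'
  set A : ℕ → ℝ := fun k => switchTotal S y' (I k) with hA
  set B : ℕ → ℝ := fun k => ∑ u ∈ blk x I k, T x u * T u y with hB
  have h1η : 0 < 1 - η := by linarith
  have hSy : 0 < S y' := hS y'
  have h𝒦pos : (0 : ℝ) < #𝒦 := by exact_mod_cast card_pos.2 h𝒦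
  -- (F1) `B_k ≥ (1-η)² S(y') A_k > 0`
  have hApos : ∀ k ∈ 𝒦, 0 < A k := by
    intro k hk
    have hIne : (I k).Nonempty := by
      rw [← Finset.card_pos]
      have : (0 : ℝ) < #(I k) := lt_of_lt_of_le (by positivity) (hcard k hk)
      exact_mod_cast this
    exact Finset.sum_pos (fun u _ => switchCoeff_pos hS y' u) hIne
  have hBge : ∀ k ∈ 𝒦, (1 - η) ^ 2 * S y' * A k ≤ B k := by
    intro k hk
    have hexp : (1 - η) ^ 2 * S y' * A k = ∑ v ∈ blk x I k, (1 - η) ^ 2 * (S ((v : Site d) - x) * S ((y : Site d) - v)) := by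
      rw [hA]
      simp only []
      unfold switchTotal
      rw [Finset.mul_sum, ← sum_blk_eq x I k (hIΛ k hk) (fun u => (1 - η) ^ 2 * S y' * switchCoeff S y' u)]
      refine Finset.sum_congr rfl fun v _ => ?_
      unfold switchCoeff
      rw [hy', show (y : Site d) - x - ((v : Site d) - x) = (y : Site d) - v by abel]
      have hne : S ((y : Site d) - x) ≠ 0 := (hS _).ne'
      field_simp
    rw [hexp, hB]
    refine Finset.sum_le_sum fun v hv => ?_
    obtain ⟨h1, h2⟩ := hlow_blk k hk v hv
    calc (1 - η) ^ 2 * (S ((v : Site d) - x) * S ((y : Site d) - v))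
        = ((1 - η) * S ((v : Site d) - x)) * ((1 - η) * S ((y : Site d) - v)) := by ring
      _ ≤ T x v * T v y := mul_le_mul h1 h2 (mul_nonneg h1η.le (hS _).le) (hTnn _ _)
  have hBpos : ∀ k ∈ 𝒦, 0 < B k := fun k hk =>
    lt_of_lt_of_le (mul_pos (mul_pos (pow_pos h1η 2) hSy) (hApos k hk)) (hBge k hk)
  -- (F3) the coefficients: `T_{xy}/(|𝒦| B_k) ≤ 1/(|𝒦|(1-η)² A_k)`
  have hTxy : T x y ≤ S y' := hTle x y
  have hcoef : ∀ k ∈ 𝒦, T x y / (#𝒦 * B k) ≤ 1 / (#𝒦 * ((1 - η) ^ 2 * A k)) := by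
    intro k hk
    rw [div_le_div_iff₀ (mul_pos h𝒦pos (hBpos k hk)) (by have := hApos k hk; positivity), one_mul]
    calc T x y * (#𝒦 * ((1 - η) ^ 2 * A k)) ≤ S y' * (#𝒦 * ((1 - η) ^ 2 * A k)) := by
          have := hApos k hk
          exact mul_le_mul_of_nonneg_right hTxy (by positivity)
      _ = #𝒦 * ((1 - η) ^ 2 * S y' * A k) := by ring
      _ ≤ #𝒦 * B k := mul_le_mul_of_nonneg_left (hBge k hk) h𝒦pos.le
  have hcoef0 : ∀ k ∈ 𝒦, 0 ≤ T x y / (#𝒦 * B k) := fun k hk =>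
    div_nonneg (hTnn x y) (mul_nonneg h𝒦pos.le (hBpos k hk).le)
  -- (F2) the two-site sums through `S`
  have hΦ : ∀ k ∈ 𝒦, ∀ ℓ ∈ 𝒦, ∑ v ∈ blk x I k, ∑ w ∈ blk x I ℓ, (T x w * T w v * T v y + T x v * T v w * T w y) ≤
      S y' * ∑ v' ∈ I k, ∑ w' ∈ I ℓ, twoSiteTerm S y' v' w' := by
    intro k hk ℓ hℓ
    rw [Finset.mul_sum, ← sum_blk_eq x I k (hIΛ k hk) (fun v' => S y' * ∑ w' ∈ I ℓ, twoSiteTerm S y' v' w')]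
    refine Finset.sum_le_sum fun v _ => ?_
    rw [Finset.mul_sum, ← sum_blk_eq x I ℓ (hIΛ ℓ hℓ) (fun w' => S y' * twoSiteTerm S y' ((v : Site d) - x) w')]
    refine Finset.sum_le_sum fun w _ => ?_
    have hterm : S y' * twoSiteTerm S y' ((v : Site d) - x) ((w : Site d) - x) =
        S ((w : Site d) - x) * S ((v : Site d) - w) * S ((y : Site d) - v) +
          S ((v : Site d) - x) * S ((w : Site d) - v) * S ((y : Site d) - w) := by
      unfold twoSiteTerm
      rw [mul_div_cancel₀ _ hSy.ne', hy']
      have e1 : (v : Site d) - x - ((w : Site d) - x) = (v : Site d) - w := by abel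
      have e2 : (y : Site d) - x - ((v : Site d) - x) = (y : Site d) - v := by abel
      have e3 : (w : Site d) - x - ((v : Site d) - x) = (w : Site d) - v := by abel
      have e4 : (y : Site d) - x - ((w : Site d) - x) = (y : Site d) - w := by abel
      rw [e1, e2, e3, e4]
    rw [hterm]
    have hT3 : ∀ a b c : ↥Λ, T x a * T a b * T b y ≤ S ((a : Site d) - x) * S ((b : Site d) - a) * S ((y : Site d) - b) :=
      fun a b c => mul_le_mul (mul_le_mul (hTle _ _) (hTle _ _) (hTnn _ _) (hS _).le) (hTle _ _) (hTnn _ _)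
        (mul_nonneg (hS _).le (hS _).le)
    exact add_le_add (hT3 w v v) (hT3 v w w)
  -- combine
  have hnum := sum_inv_mul_sum_twoSiteTerm_le hS i₀ hc hC hκ hγ 𝒦 hreg hsep hY y' I hI hcard hdom
  rw [← hCst] at hnum
  calc ∑ k ∈ 𝒦, ∑ ℓ ∈ 𝒦, (T x y / (#𝒦 * B k)) * (T x y / (#𝒦 * B ℓ)) *
        ∑ v ∈ blk x I k, ∑ w ∈ blk x I ℓ, (T x w * T w v * T v y + T x v * T v w * T w y)
      ≤ ∑ k ∈ 𝒦, ∑ ℓ ∈ 𝒦, (1 / (#𝒦 * ((1 - η) ^ 2 * A k))) * (1 / (#𝒦 * ((1 - η) ^ 2 * A ℓ))) *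
          (S y' * ∑ v' ∈ I k, ∑ w' ∈ I ℓ, twoSiteTerm S y' v' w') := by
        refine Finset.sum_le_sum fun k hk => Finset.sum_le_sum fun ℓ hℓ => ?_
        have h0 : 0 ≤ ∑ v ∈ blk x I k, ∑ w ∈ blk x I ℓ, (T x w * T w v * T v y + T x v * T v w * T w y) :=
          Finset.sum_nonneg fun v _ => Finset.sum_nonneg fun w _ =>
            add_nonneg (mul_nonneg (mul_nonneg (hTnn _ _) (hTnn _ _)) (hTnn _ _))
              (mul_nonneg (mul_nonneg (hTnn _ _) (hTnn _ _)) (hTnn _ _))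
        exact mul_le_mul (mul_le_mul (hcoef k hk) (hcoef ℓ hℓ) (hcoef0 ℓ hℓ)
          (div_nonneg zero_le_one (by have := hApos k hk; positivity))) (hΦ k hk ℓ hℓ) h0
          (mul_nonneg (div_nonneg zero_le_one (by have := hApos k hk; positivity))
            (div_nonneg zero_le_one (by have := hApos ℓ hℓ; positivity)))
    _ = S y' / (#𝒦 ^ 2 * (1 - η) ^ 4) *
          ∑ k ∈ 𝒦, ∑ ℓ ∈ 𝒦, (A k * A ℓ)⁻¹ * ∑ v' ∈ I k, ∑ w' ∈ I ℓ, twoSiteTerm S y' v' w' := by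
        rw [Finset.mul_sum]
        refine Finset.sum_congr rfl fun k hk => ?_
        rw [Finset.mul_sum]
        refine Finset.sum_congr rfl fun ℓ hℓ => ?_
        have hAk := (hApos k hk).ne'
        have hAℓ := (hApos ℓ hℓ).ne'
        field_simp
    _ ≤ S y' / (#𝒦 ^ 2 * (1 - η) ^ 4) * ((#𝒦 : ℝ) ^ 2 + Cst * #𝒦) :=
        mul_le_mul_of_nonneg_left hnum (by positivity)
    _ = (1 - η)⁻¹ ^ 4 * (1 + Cst / #𝒦) * S y' := by field_simp
    _ ≤ (1 - η)⁻¹ ^ 4 * (1 + Cst / #𝒦) * ((1 - η)⁻¹ * T x y) := by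
        have hCst0 : 0 ≤ Cst := by rw [hCst]; positivity
        refine mul_le_mul_of_nonneg_left ?_ (by positivity)
        rw [le_inv_mul_iff₀ h1η]; exact hlow_xy
    _ = (1 - η)⁻¹ ^ 5 * (1 + Cst / #𝒦) * T x y := by ring

/-- Expanding the square of a block-wise constant function against a kernel:
`∑_{v,w} (∑_k 𝟙[P_k v] g_k)(∑_ℓ 𝟙[P_ℓ w] g_ℓ) Φ(v,w) = ∑_{k,ℓ} g_k g_ℓ ∑_{P_k v} ∑_{P_ℓ w} Φ(v,w)`. [folklore] -/
theorem sum_sum_blockCoeff_mul {α ι : Type*} [Fintype α] (s : Finset ι) (P : ι → α → Prop)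
    [∀ k, DecidablePred (P k)] (g : ι → ℝ) (Φ : α → α → ℝ) :
    ∑ v, ∑ w, (∑ k ∈ s, if P k v then g k else 0) * (∑ ℓ ∈ s, if P ℓ w then g ℓ else 0) * Φ v w =
      ∑ k ∈ s, ∑ ℓ ∈ s, g k * g ℓ * ∑ v ∈ univ.filter (P k), ∑ w ∈ univ.filter (P ℓ), Φ v w := by
  -- pointwise expansion
  have hpt : ∀ v w, (∑ k ∈ s, if P k v then g k else 0) * (∑ ℓ ∈ s, if P ℓ w then g ℓ else 0) * Φ v w =
      ∑ k ∈ s, ∑ ℓ ∈ s, (if P k v then (if P ℓ w then g k * g ℓ * Φ v w else 0) else 0) := by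
    intro v w
    rw [Finset.sum_mul_sum, Finset.sum_mul]
    refine Finset.sum_congr rfl fun k _ => ?_
    rw [Finset.sum_mul]
    refine Finset.sum_congr rfl fun ℓ _ => ?_
    split_ifs <;> ring
  simp_rw [hpt]
  -- reorder the four sums: (v w k ℓ) → (k ℓ v w)
  rw [Finset.sum_comm]  -- (k v w ℓ)? no: swaps v with the next binder w… do it stepwise below
  rw [Finset.sum_comm]
  -- now the order is back to (v w k ℓ); proceed carefully with congruences
  have h1 : ∑ v, ∑ w, ∑ k ∈ s, ∑ ℓ ∈ s, (if P k v then (if P ℓ w then g k * g ℓ * Φ v w else 0) else 0) =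
      ∑ v, ∑ k ∈ s, ∑ w, ∑ ℓ ∈ s, (if P k v then (if P ℓ w then g k * g ℓ * Φ v w else 0) else 0) :=
    Finset.sum_congr rfl fun v _ => Finset.sum_comm
  have h2 : ∑ v, ∑ k ∈ s, ∑ w, ∑ ℓ ∈ s, (if P k v then (if P ℓ w then g k * g ℓ * Φ v w else 0) else 0) =
      ∑ k ∈ s, ∑ v, ∑ w, ∑ ℓ ∈ s, (if P k v then (if P ℓ w then g k * g ℓ * Φ v w else 0) else 0) :=
    Finset.sum_comm
  have h3 : ∑ k ∈ s, ∑ v, ∑ w, ∑ ℓ ∈ s, (if P k v then (if P ℓ w then g k * g ℓ * Φ v w else 0) else 0) =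
      ∑ k ∈ s, ∑ v, ∑ ℓ ∈ s, ∑ w, (if P k v then (if P ℓ w then g k * g ℓ * Φ v w else 0) else 0) :=
    Finset.sum_congr rfl fun k _ => Finset.sum_congr rfl fun v _ => Finset.sum_comm
  have h4 : ∑ k ∈ s, ∑ v, ∑ ℓ ∈ s, ∑ w, (if P k v then (if P ℓ w then g k * g ℓ * Φ v w else 0) else 0) =
      ∑ k ∈ s, ∑ ℓ ∈ s, ∑ v, ∑ w, (if P k v then (if P ℓ w then g k * g ℓ * Φ v w else 0) else 0) :=
    Finset.sum_congr rfl fun k _ => Finset.sum_comm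
  rw [h1, h2, h3, h4]
  refine Finset.sum_congr rfl fun k _ => Finset.sum_congr rfl fun ℓ _ => ?_
  rw [Finset.sum_filter, Finset.mul_sum]
  refine Finset.sum_congr rfl fun v _ => ?_
  split_ifs with hv
  · rw [Finset.sum_filter, Finset.mul_sum]
    refine Finset.sum_congr rfl fun w _ => ?_
    split_ifs <;> ring
  · simp

/-- **(hB) for the finite-volume coefficients: `E^{xy,∅}[𝐍ᵢ²] ≤ q`** with `q = (1-η)⁻⁵(1 + C_*/|𝒦|)`, in the
un-normalised form of `Current.mixingCore` (`Z[∅] ∑ w 𝐍² ≤ q Z[xy]Z[∅]²`): Prop. A.3 reduces the second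
moment to the two-site sums (`ecurrentSum_mul_tsum_epairWeight_mul_nPair_sq_le`), which are compared with
their infinite-volume counterparts (`(1-η)S ≤ ⟨·⟩_Λ ≤ S` on the pairs involved) and bounded by (6.5)
(`sum_inv_mul_sum_twoSiteTerm_le`: regular separated scales, index sets of size `≥ γ2^{dk}` in the annuli,
domination for the far source). [cite: AizenmanDuminilCopinAnnals2021, arXiv:1912.07973 §6.2, Prop. 6.6 and its proof (pp. 23–24)] -/
theorem mixCoeff_secondMoment_le (hβ : 0 ≤ β) (hS : ∀ z, 0 < twoPointFree d β z) (i₀ : Fin d)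
    {c C κ Y γ η : ℝ} (hc : 0 < c) (hC : 0 ≤ C) (hκ : 0 ≤ κ) (hγ : 0 < γ) (hη1 : η < 1) (h𝒦 : 𝒦.Nonempty)
    (hreg : ∀ j ∈ 𝒦, IsRegularScale (twoPointFree d β) c C (2 ^ j))
    (hsep : ∀ j ∈ 𝒦, ∀ j' ∈ 𝒦, j < j' → (C + 2) * 2 ^ j < (2 ^ j' : ℝ))
    (hY : ∀ j ∈ 𝒦, (2 ^ j : ℝ) ≤ Y) (hI : ∀ j ∈ 𝒦, I j ⊆ ann d (2 ^ j) (2 * 2 ^ j))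
    (hcard : ∀ j ∈ 𝒦, γ * (2 ^ j : ℝ) ^ d ≤ #(I j))
    (hdom : ∀ j ∈ 𝒦, ∀ u ∈ I j, twoPointFree d β ((y : Site d) - x) ≤
      (1 + κ * 2 ^ j / Y) * twoPointFree d β ((y : Site d) - x - u))
    (hIΛ : ∀ j ∈ 𝒦, ∀ u ∈ I j, (x : Site d) + u ∈ Λ)
    (hlow_xy : (1 - η) * twoPointFree d β ((y : Site d) - x) ≤ boxTwoPt Λ β x y)
    (hlow_blk : ∀ j ∈ 𝒦, ∀ v ∈ blk x I j,
      (1 - η) * twoPointFree d β ((v : Site d) - x) ≤ boxTwoPt Λ β x v ∧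
        (1 - η) * twoPointFree d β ((y : Site d) - v) ≤ boxTwoPt Λ β v y) :
    ecurrentSum (Kc Λ β) ∅ * ∑' p : Current (boxGraph Λ) × Current (boxGraph Λ),
        epairWeight (Kc Λ β) ({x} ∆ {y}) ∅ p * nPair x (mixCoeff β x y 𝒦 I) (p.1 + p.2) ^ 2 ≤
      ENNReal.ofReal ((1 - η)⁻¹ ^ 5 * (1 + ((2 * C * ((1 + (1 + c) / c) * 9 ^ d * C ^ 2 * (1 + κ) / γ)) +
        4 * ((1 + κ) * C + (2 * C + κ + 2 * C * κ))) / #𝒦)) *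
        (ecurrentSum (Kc Λ β) ({x} ∆ {y}) * ecurrentSum (Kc Λ β) ∅ ^ 2) := by
  classical
  have hK : ∀ e, 0 ≤ Kc Λ β e := fun _ => hβ
  set Cst : ℝ := (2 * C * ((1 + (1 + c) / c) * 9 ^ d * C ^ 2 * (1 + κ) / γ)) +
    4 * ((1 + κ) * C + (2 * C + κ + 2 * C * κ)) with hCst
  have hCst0 : 0 ≤ Cst := by rw [hCst]; positivity
  have h1η : 0 < 1 - η := by linarith
  -- the dictionary (opaque names for the real quantities)
  obtain ⟨z0, hz0⟩ : ∃ z0 : ℝ, z0 = (ecurrentSum (Kc Λ β) ∅).toReal := ⟨_, rfl⟩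
  have hz0pos : 0 < z0 := by rw [hz0]; exact ENNReal.toReal_pos (ecurrentSum_empty_ne_zero _) (ecurrentSum_ne_top hK _)
  obtain ⟨T, hT⟩ : ∃ T : ↥Λ → ↥Λ → ℝ, T = boxTwoPt Λ β := ⟨_, rfl⟩
  rw [← hT] at hlow_xy hlow_blk
  have hTnn : ∀ a b, 0 ≤ T a b := fun a b => by
    rw [hT, boxTwoPt_eq_div hβ]; exact div_nonneg ENNReal.toReal_nonneg ENNReal.toReal_nonneg
  have hTle : ∀ a b, T a b ≤ twoPointFree d β ((b : Site d) - a) := fun a b => by rw [hT]; exact boxTwoPt_le hβ a b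
  have hZ : ∀ a b : ↥Λ, ecurrentSum (Kc Λ β) ({a} ∆ {b}) = ENNReal.ofReal (T a b * z0) := fun a b => by
    rw [hT, hz0, ← toReal_ecurrentSum_pair hβ, ENNReal.ofReal_toReal (ecurrentSum_ne_top hK _)]
  have hZ0 : ecurrentSum (Kc Λ β) ∅ = ENNReal.ofReal z0 := by
    rw [hz0]; exact (ENNReal.ofReal_toReal (ecurrentSum_ne_top hK _)).symm
  -- the real block sums and their positivity
  obtain ⟨B, hB⟩ : ∃ B : ℕ → ℝ, B = fun k => ∑ u ∈ blk x I k, T x u * T u y := ⟨_, rfl⟩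
  have hBk : ∀ k, B k = ∑ u ∈ blk x I k, T x u * T u y := fun k => by rw [hB]
  have hBnn : ∀ k, 0 ≤ B k := fun k => by rw [hBk]; exact Finset.sum_nonneg fun u _ => mul_nonneg (hTnn _ _) (hTnn _ _)
  have hBpos : ∀ k ∈ 𝒦, 0 < B k := by
    intro k hk
    rw [hBk]
    have hne : (blk x I k).Nonempty := by
      rw [← Finset.card_pos]
      have h1 : (0 : ℝ) < #(I k) := lt_of_lt_of_le (by positivity) (hcard k hk)
      rw [← card_blk_eq x I k (hIΛ k hk)] at h1
      exact_mod_cast h1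
    refine Finset.sum_pos (fun u hu => ?_) hne
    obtain ⟨h1, h2⟩ := hlow_blk k hk u hu
    exact mul_pos (lt_of_lt_of_le (mul_pos h1η (hS _)) h1) (lt_of_lt_of_le (mul_pos h1η (hS _)) h2)
  have hbs : ∀ k, blkSum β x y I k = ENNReal.ofReal (z0 ^ 2 * B k) := by
    intro k
    unfold blkSum
    have hterm : ∀ u ∈ blk x I k, ecurrentSum (Kc Λ β) ({x} ∆ {u}) * ecurrentSum (Kc Λ β) ({u} ∆ {y}) =
        ENNReal.ofReal (z0 ^ 2 * (T x u * T u y)) := by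
      intro u _
      rw [hZ, hZ, ← ENNReal.ofReal_mul (mul_nonneg (hTnn _ _) hz0pos.le)]
      congr 1; ring
    rw [Finset.sum_congr rfl hterm, ← ENNReal.ofReal_sum_of_nonneg (fun u _ => by
      have := hTnn x u; have := hTnn u y; positivity), ← Finset.mul_sum, hBk]
  -- the coefficients as real numbers
  obtain ⟨g, hg⟩ : ∃ g : ℕ → ℝ, g = fun k => T x y / (#𝒦 * B k) := ⟨_, rfl⟩
  have hgk : ∀ k, g k = T x y / (#𝒦 * B k) := fun k => by rw [hg]
  have hgnn : ∀ k ∈ 𝒦, 0 ≤ g k := fun k hk => by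
    rw [hgk]; exact div_nonneg (hTnn x y) (mul_nonneg (Nat.cast_nonneg _) (hBnn k))
  have h𝒦pos : (0 : ℝ) < #𝒦 := by exact_mod_cast card_pos.2 h𝒦
  have hcoef : ∀ v : ↥Λ, mixCoeff β x y 𝒦 I v =
      ENNReal.ofReal (∑ k ∈ 𝒦, if ((v : Site d) - x) ∈ I k then g k else 0) := by
    intro v
    unfold mixCoeff
    rw [ENNReal.ofReal_sum_of_nonneg (fun k hk => by split_ifs; exacts [hgnn k hk, le_rfl])]
    refine Finset.sum_congr rfl fun k hk => ?_
    split_ifs with hv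
    · rw [hZ, hZ0, hbs, show (((#𝒦 : ℕ) : ℝ≥0∞)) = ENNReal.ofReal (#𝒦 : ℝ) by rw [ENNReal.ofReal_natCast],
        ← ENNReal.ofReal_inv_of_pos h𝒦pos, ← ENNReal.ofReal_inv_of_pos (mul_pos (pow_pos hz0pos 2) (hBpos k hk)),
        ← ENNReal.ofReal_mul (mul_nonneg (hTnn x y) hz0pos.le), ← ENNReal.ofReal_mul (inv_nonneg.2 h𝒦pos.le),
        ← ENNReal.ofReal_mul (mul_nonneg (mul_nonneg (hTnn x y) hz0pos.le) hz0pos.le)]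
      congr 1
      rw [hgk, div_eq_mul_inv, mul_inv, mul_inv]
      have hzz : z0 * z0 * (z0 ^ 2)⁻¹ = 1 := by rw [← sq, mul_inv_cancel₀ (pow_ne_zero 2 hz0pos.ne')]
      calc T x y * z0 * z0 * ((#𝒦 : ℝ)⁻¹ * ((z0 ^ 2)⁻¹ * (B k)⁻¹))
          = T x y * ((#𝒦 : ℝ)⁻¹ * (B k)⁻¹) * (z0 * z0 * (z0 ^ 2)⁻¹) := by ring
        _ = T x y * ((#𝒦 : ℝ)⁻¹ * (B k)⁻¹) := by rw [hzz, mul_one]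
    · rw [ENNReal.ofReal_zero]
  -- the two-site kernel as a real number
  have hF : ∀ v w : ↥Λ, ecurrentSum (Kc Λ β) ({x} ∆ {w}) * ecurrentSum (Kc Λ β) ({w} ∆ {v}) * ecurrentSum (Kc Λ β) ({v} ∆ {y}) +
      ecurrentSum (Kc Λ β) ({x} ∆ {v}) * ecurrentSum (Kc Λ β) ({v} ∆ {w}) * ecurrentSum (Kc Λ β) ({w} ∆ {y}) =
      ENNReal.ofReal (z0 ^ 3 * (T x w * T w v * T v y + T x v * T v w * T w y)) := by
    intro v w
    simp only [hZ]
    rw [← ENNReal.ofReal_mul (by have := hTnn x w; positivity), ← ENNReal.ofReal_mul (by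
        have := hTnn x w; have := hTnn w v; positivity),
      ← ENNReal.ofReal_mul (by have := hTnn x v; positivity), ← ENNReal.ofReal_mul (by
        have := hTnn x v; have := hTnn v w; positivity),
      ← ENNReal.ofReal_add (by have := hTnn x w; have := hTnn w v; have := hTnn v y; positivity)
        (by have := hTnn x v; have := hTnn v w; have := hTnn w y; positivity)]
    congr 1; ring
  -- Prop. A.3 and the conversion to real numbers
  refine (ecurrentSum_mul_tsum_epairWeight_mul_nPair_sq_le hK x y (mixCoeff β x y 𝒦 I)).trans ?_
  have hsum : ∑ v, ∑ w, mixCoeff β x y 𝒦 I v * mixCoeff β x y 𝒦 I w *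
      (ecurrentSum (Kc Λ β) ({x} ∆ {w}) * ecurrentSum (Kc Λ β) ({w} ∆ {v}) * ecurrentSum (Kc Λ β) ({v} ∆ {y}) +
        ecurrentSum (Kc Λ β) ({x} ∆ {v}) * ecurrentSum (Kc Λ β) ({v} ∆ {w}) * ecurrentSum (Kc Λ β) ({w} ∆ {y})) =
      ENNReal.ofReal (∑ v : ↥Λ, ∑ w : ↥Λ, (∑ k ∈ 𝒦, if ((v : Site d) - x) ∈ I k then g k else 0) *
        (∑ k ∈ 𝒦, if ((w : Site d) - x) ∈ I k then g k else 0) *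
          (z0 ^ 3 * (T x w * T w v * T v y + T x v * T v w * T w y))) := by
    have hrc : ∀ v : ↥Λ, 0 ≤ ∑ k ∈ 𝒦, (if ((v : Site d) - x) ∈ I k then g k else 0) := fun v =>
      Finset.sum_nonneg fun k hk => by split_ifs; exacts [hgnn k hk, le_rfl]
    have hΦ : ∀ v w : ↥Λ, 0 ≤ z0 ^ 3 * (T x w * T w v * T v y + T x v * T v w * T w y) := fun v w => by
      have := hTnn x w; have := hTnn w v; have := hTnn v y; have := hTnn x v; have := hTnn v w; have := hTnn w y
      positivity
    rw [ENNReal.ofReal_sum_of_nonneg (fun v _ => Finset.sum_nonneg fun w _ =>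
      mul_nonneg (mul_nonneg (hrc v) (hrc w)) (hΦ v w))]
    refine Finset.sum_congr rfl fun v _ => ?_
    rw [ENNReal.ofReal_sum_of_nonneg (fun w _ => mul_nonneg (mul_nonneg (hrc v) (hrc w)) (hΦ v w))]
    refine Finset.sum_congr rfl fun w _ => ?_
    rw [hcoef, hcoef, hF, ← ENNReal.ofReal_mul (hrc v), ← ENNReal.ofReal_mul (mul_nonneg (hrc v) (hrc w))]
  have hq0 : (0 : ℝ) ≤ (1 - η)⁻¹ ^ 5 * (1 + Cst / #𝒦) :=
    mul_nonneg (pow_nonneg (inv_nonneg.2 h1η.le) 5) (add_nonneg zero_le_one (div_nonneg hCst0 (Nat.cast_nonneg _)))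
  rw [hsum, hZ, hZ0, ← ENNReal.ofReal_pow hz0pos.le, ← ENNReal.ofReal_mul (mul_nonneg (hTnn x y) hz0pos.le),
    ← ENNReal.ofReal_mul hq0]
  refine ENNReal.ofReal_le_ofReal ?_
  -- the real inequality
  have hexp := sum_sum_blockCoeff_mul 𝒦 (fun k (v : ↥Λ) => ((v : Site d) - x) ∈ I k) g
    (fun v w => z0 ^ 3 * (T x w * T w v * T v y + T x v * T v w * T w y))
  rw [hexp]
  have hreal := real_secondMoment_le x y 𝒦 I hS T hTle hTnn i₀ hc hC hκ hγ hη1 h𝒦 hreg hsep hY hI hcard hdom hIΛ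
    hlow_xy hlow_blk
  rw [← hCst] at hreal
  simp_rw [← hBk] at hreal
  have hblk' : ∀ k, (univ.filter fun v : ↥Λ => ((v : Site d) - x) ∈ I k) = blk x I k := fun k => rfl
  simp_rw [hblk']
  calc ∑ k ∈ 𝒦, ∑ ℓ ∈ 𝒦, g k * g ℓ * ∑ v ∈ blk x I k, ∑ w ∈ blk x I ℓ,
          z0 ^ 3 * (T x w * T w v * T v y + T x v * T v w * T w y)
      = z0 ^ 3 * ∑ k ∈ 𝒦, ∑ ℓ ∈ 𝒦, (T x y / (#𝒦 * B k)) * (T x y / (#𝒦 * B ℓ)) *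
          ∑ v ∈ blk x I k, ∑ w ∈ blk x I ℓ, (T x w * T w v * T v y + T x v * T v w * T w y) := by
        rw [Finset.mul_sum]
        refine Finset.sum_congr rfl fun k _ => ?_
        rw [Finset.mul_sum]
        refine Finset.sum_congr rfl fun ℓ _ => ?_
        rw [hgk, hgk]
        simp only [← Finset.mul_sum]
        ring
    _ ≤ z0 ^ 3 * ((1 - η)⁻¹ ^ 5 * (1 + Cst / #𝒦) * T x y) := mul_le_mul_of_nonneg_left hreal (by positivity)
    _ = (1 - η)⁻¹ ^ 5 * (1 + Cst / #𝒦) * (T x y * z0 * z0 ^ 2) := by ring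

end Coeff

end Current

end Literature.Probability.LatticeModels
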